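import Summits.QuantumFields.YangMills.Theorems.UnitScaleTiltProp7AccumulatedFrameStep
import Summits.QuantumFields.YangMills.Theorems.UnitScaleTiltProp7QTwSCentralTowerRows
import Summits.QuantumFields.YangMills.Theorems.UnitScaleTiltProp7TowerClosenessOfRegPr
import HarnessLib

/-!
# Route `UnitScaleTilt`, crux K1 «MinimiserStabilityRegPr» (stmt-QuantumFields-19200), route-R E′ (A′) «HCOW-VIA-Σ», row P-A2 «JOINT-Σ», file F3″-SUP (2∕2) —
# THE ACCUMULATED-FRAME SUP AT EVERY LEVEL, THE SINGLE-BAR RATIO SUPS, AND (★) AT THE T³ MEMBER WITH `hv`∕`ha` DISCHARGED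

Cell `ym3-torus`, width seat `ym-routeR-w4` (gen 14); offer «F3″-SEAM+SUP-T³» to the F3″ pen ★px22 g3 (LOCATE `LOCATE-PA2-F3-LEVELMASSES-px22g3.md` (V4)∕(R2): «the sup inhabitant must come
from the EX lane's direct frame bounds under `RegPr`, not from the recursion») and the E′ namer ★p1 g17.  THE POINT.  The `ℓ²` assembly of F3″'s one-step inequality (★)
(✓ `Prop7AccumulatedFrameStep.norm_frameAccU_succ_sub_one_le`: `‖ν_{l+1}(y) − 1‖ ≤ |I|⁻¹Σ_i(‖R_i − 1‖ + ‖a_i − 1‖) + 6t²`) displays per-level SUP letters — the accumulated frames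
`‖ν_l(x) − 1‖ ≤ δ`, the single-bar stair ratios `‖R_i(y) − 1‖ ≤ δ`, the twisted stairs `t`, and the norm-`≤ 1` rows `hv`∕`ha` — whose T³ inhabitants at `U₀ ∈ 𝔘_k(ε₀)` printed-regular,
chart point `U′ = e^{A₁}U₀` (`‖A₁‖ < e·η`), windows `10¹²L³ε₀ ≤ 1`, `10⁹L²e ≤ 1`, are supplied here for EVERY level (the tree had the frame bound at the top level only,
✓ `Prop7DbarTwSymWindow.norm_dbarTwS_sub_one_le`, and ✓ `norm_dbarCovIterU_rel_sub_one_le_of_regPr` keeps only the bond conjunct of W3):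

* §1 (generic) the `U1` letter `norm_mul_mul_sub_one_le_of_U1`: `‖abc − 1‖ ≤ ‖a − 1‖ + ‖b − 1‖ + ‖c − 1‖` for `a, c ∈ U1`.
* §2 ★★ **`norm_frameAccU_bgUnits_sub_one_le_of_regPr`** — `∀ j ≤ K − n, ∀ x, ‖ν_j(x) − 1‖ ≤ 30L(2e + 2700Lε₀)` (`≤ 10⁻⁷`, `frameSup_numeral`; chart-point form
  `norm_frameAccU_chart_sub_one_le_of_regPr`): the FRAME conjuncts of W3 ✓ `Prop7SymFrameRelCluster.norm_dbarCovIterU_rel_frameAccU_le_of_plaqSmall` (`≤ 6ℓ·Lʲ(2t + 30ℓs_B)`, `ℓ = 5L`)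
  read at T³ with W2's level-`j` budgets bounded by the level-`(K−n)` ones (✓ `budget_T3_frames`, ✓ `windows_of_numerals`), exactly as ✓ `norm_dbarCovIterU_rel_sub_one_le_of_regPr` does.
* §3 ★★ `norm_emlIterU_chart_mul_inv_sub_one_le_of_regPr` — the single-bar BOND ratio of the two plain towers `‖Ū′^{(j)}(b)Ū₀^{(j)}(b)⁻¹ − 1‖ ≤ 3(2e + 2700Lε₀) + 2·30L(2e + 2700Lε₀)`
  ((97): `Ū′(b)Ū₀(b)⁻¹ = ν(b₋)·(V(b)Ū₀(b)⁻¹)·Ad_{Ū₀(b)}(ν(b₊)⁻¹)`); ★★★ **`norm_stairRatio_sub_one_le_of_regPr`** — the single-bar STAIR ratio of (★), `‖R_i(y) − 1‖ ≤ 10⁻⁶ + 2·30L(2e + 2700Lε₀)`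
  for `j < K − n` (B1's ✓ `tstairU_eq_frame_inv_mul` read backwards: `R_i = ν(ŷ)·tstair_i·a_i⁻¹`, `a_i = Ad_{Ū₀(st_i)}(ν(x_i))`, ✓ `norm_tstairU_sub_one_le_of_regPr`);
  ★★★ **`norm_frameAccU_succ_sub_one_le_of_regPr`** — (★) at the member with `hv`∕`ha` DISCHARGED (frames special unitary ✓ `frameAccU_bgUnits_mem_specialUnitaryGroup_of_regPr`, background
  stair holonomies `U1` ✓ `holT_mem_U1` ∘ ✓ `emlIterU_bgUnits_mem_U1_of_regPr`), only the site-wise stair letter `t` (`ht`, `ht4`) displayed, as the `ℓ²` assembly wants it.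
Sibling file (1∕2) `…ChartPointTowerSeam`: the seam `(Ū′^{(k)})♭ = emlIterU k U′♭` and the unitarity of both towers.  THEOREMS ONLY (0 `def`, 0 `sorry`), compositions of landed letters with
explicit numerals; `--supports stmt-QuantumFields-19200 --as helper`, count-neutral.  Nothing of F3″-B2c∕C, P-A2, `hcoW`, E′, EX or the crux is claimed; YM₃ on T³ is a ladder rung (R3),
not d = 4, not infinite volume, not a mass gap, not the Clay problem.

References: T. Bałaban, CMP **98** (1985) 17–51 [Balaban1985Averaging] ((8)–(9) pp.18–19, (19) p.21, (26)–(27) p.22, (58) p.27, (82) p.30, (89)–(92) p.31, (97) p.32, (161)–(163) p.42,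
p.44); CMP **109** (1987) 249–301 [Balaban1987RG1] ((0.4) p.253); CMP **102** (1985) 277–309 [Balaban1985Variational] ((2) p.278, (44) p.285).
-/

set_option autoImplicit false

noncomputable section

open scoped Matrix.Norms.L2Operator BigOperators

namespace Summit.QuantumFields.YangMills.Theorems.Prop7AccumulatedFrameSupT3

open NormedSpace
open Literature.MathematicalPhysics.QuantumFieldTheory.Balaban1983to89
open T3ContinuumYM3Torus
open T4Continuum BlockAveraging ExpMeanLog
open B10Eq27TorusAxialLog (holT gaugeActT gaugeActT_apply transl unitsField toUField suIncl val_suIncl)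
open B7Prop1Explicit (expUnit val_expUnit U1 mem_U1 disp norm_units_conj_sub_one_le norm_inv_sub_one_le)
open B7Prop2SpecialUnitary (specialUnitaryUnits mem_specialUnitaryUnits specialUnitaryUnits_le_U1)
open T3RegularMinimiser (regThreshold)
open T3PrintedRegularMinimiser (RegPr)
open T3SectALandauChart (eta eta_pos bgUnits)
open Summit.QuantumFields.YangMills.Theorems.Prop8Chart (emlIterU expCfg)
open Summit.QuantumFields.YangMills.Theorems.Prop7SymAvgRelativeBound (perturbedField_eq budget_T3)
open Summit.QuantumFields.YangMills.Theorems.Prop7DbarTwWindow (norm_smul_eta_inv_le)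
open Summit.QuantumFields.YangMills.Theorems.Prop7DbarTwSymWindow (budget_T3_frames windows_of_numerals hstep_T3 hframe_T3)
open Summit.QuantumFields.YangMills.Theorems.Prop7SymFrameRelCluster (norm_dbarCovIterU_rel_frameAccU_le_of_plaqSmall)
open Summit.QuantumFields.YangMills.Theorems.Prop7SymAvgGLSmallOfRegPr (bgUnits_eq)
open Summit.QuantumFields.YangMills.Theorems.Prop7SymAvgTwSym (tstairU vframeCovU dbarCovIterU frameAccU frameAccU_succ dbarCovIterU_eq_gaugeActT_frameAccU
  holT_mem_U1 emlIterU_bgUnits_mem_U1_of_regPr norm_dbarCovIterU_rel_sub_one_le_of_regPr)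
open Summit.QuantumFields.YangMills.Theorems.Prop7TowerClosenessOfRegPr (bgUnits_eq_expUnit_mul window7_of_window12 norm_tstairU_sub_one_le_of_regPr
  frameAccU_bgUnits_mem_specialUnitaryGroup_of_regPr)
open Summit.QuantumFields.YangMills.Theorems.Prop7AccumulatedFrameStep (tstairU_eq_frame_inv_mul norm_frameAccU_succ_sub_one_le)

/-! ## §1 Generic: a `U1` letter -/

section Generic

variable {𝔸 : Type*} [NormedRing 𝔸]

/-- `‖a·b·c − 1‖ ≤ ‖a − 1‖ + ‖b − 1‖ + ‖c − 1‖` for `a, c ∈ U1` (`abc − 1 = a(b − 1)c + (a − 1)c + (c − 1)`). [folklore] -/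
theorem norm_mul_mul_sub_one_le_of_U1 [NormOneClass 𝔸] {a c : 𝔸ˣ} (ha : a ∈ U1 𝔸) (hc : c ∈ U1 𝔸) (b : 𝔸) :
    ‖(a : 𝔸) * b * (c : 𝔸) - 1‖ ≤ ‖(a : 𝔸) - 1‖ + ‖b - 1‖ + ‖(c : 𝔸) - 1‖ := by
  have e : (a : 𝔸) * b * (c : 𝔸) - 1 = (a : 𝔸) * (b - 1) * (c : 𝔸) + (((a : 𝔸) - 1) * (c : 𝔸) + ((c : 𝔸) - 1)) := by noncomm_ring
  rw [e]
  have h1 : ‖(a : 𝔸) * (b - 1) * (c : 𝔸)‖ ≤ ‖b - 1‖ :=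
    calc ‖(a : 𝔸) * (b - 1) * (c : 𝔸)‖ ≤ ‖(a : 𝔸)‖ * ‖b - 1‖ * ‖(c : 𝔸)‖ := norm_mul₃_le
      _ ≤ 1 * ‖b - 1‖ * 1 := by
          gcongr
          · exact (mem_U1.1 ha).1
          · exact (mem_U1.1 hc).1
      _ = ‖b - 1‖ := by ring
  have h2 : ‖((a : 𝔸) - 1) * (c : 𝔸)‖ ≤ ‖(a : 𝔸) - 1‖ :=
    calc ‖((a : 𝔸) - 1) * (c : 𝔸)‖ ≤ ‖(a : 𝔸) - 1‖ * ‖(c : 𝔸)‖ := norm_mul_le _ _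
      _ ≤ ‖(a : 𝔸) - 1‖ * 1 := by gcongr; exact (mem_U1.1 hc).1
      _ = ‖(a : 𝔸) - 1‖ := mul_one _
  calc _ ≤ ‖(a : 𝔸) * (b - 1) * (c : 𝔸)‖ + (‖((a : 𝔸) - 1) * (c : 𝔸)‖ + ‖(c : 𝔸) - 1‖) := norm_add_le_of_le le_rfl (norm_add_le _ _)
    _ ≤ ‖b - 1‖ + (‖(a : 𝔸) - 1‖ + ‖(c : 𝔸) - 1‖) := add_le_add h1 (add_le_add h2 le_rfl)
    _ = _ := by ring

end Generic

/-! ## §2 The T³ member: the accumulated frames are within `30L(2e + 2700Lε₀)` of `1` at EVERY level -/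

section T3

variable (F : T3Family) {n K : ℕ}

/-- ★★ **THE ACCUMULATED-FRAME SUP AT EVERY LEVEL `j ≤ K − n`** (px22's LOCATE (R2): the sup inhabitant of F3″'s `δ`-window comes from the EX chain, not from the recursion):
at `U₀ ∈ 𝔘_k(ε₀)` (`10¹²L³ε₀ ≤ 1`), for `‖A(b)‖ ≤ e·η` (`10⁹L²e ≤ 1`), every `j ≤ K − n` and every site `x` of `T^{(j)}`,
`‖ν_j(x) − 1‖ ≤ 30L·(2e + 2700Lε₀)` for `ν_j = frameAccU j U₀♭ (e^{A}U₀♭)` — the FRAME conjuncts of W3 ✓`norm_dbarCovIterU_rel_frameAccU_le_of_plaqSmall` (`≤ 6ℓ·Lʲ(2t + 30ℓs_B)`,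
`ℓ = 5L`) read at T³ with W2's level-`j` budgets bounded by the level-`(K−n)` ones (✓`budget_T3_frames`, ✓`windows_of_numerals`; the bond conjunct is ✓`norm_dbarCovIterU_rel_sub_one_le_of_regPr`,
the top-level frame bound is ✓`norm_dbarTwS_sub_one_le`).  [cite: Balaban1985Averaging, (97) p.32, (161)-(163) p.42, p.44; Balaban1985Variational, (2) p.278, (44) p.285] -/
theorem norm_frameAccU_bgUnits_sub_one_le_of_regPr {ε₀ e : ℝ} (hε₀ : 0 < ε₀) (he : 0 ≤ e) (hWe : 10 ^ 9 * (F.L : ℝ) ^ 2 * e ≤ 1) (hWε : 10 ^ 12 * (F.L : ℝ) ^ 3 * ε₀ ≤ 1)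
    (U₀ : GaugeField (F.P K) 0 (Matrix.specialUnitaryGroup (Fin 2) ℂ)) (hreg : RegPr F n K ε₀ U₀)
    (A : PBond (F.P K) 0 → Matrix (Fin 2) (Fin 2) ℂ) (hA : ∀ b, ‖A b‖ ≤ e * eta F n K) {j : ℕ} (hj : j ≤ K - n) (x : Site (F.P K) j) :
    ‖((frameAccU j (bgUnits F K U₀) (fun b => expUnit (A b) * bgUnits F K U₀ b) x : (Matrix (Fin 2) (Fin 2) ℂ)ˣ) : Matrix (Fin 2) (Fin 2) ℂ) - 1‖ ≤
      30 * (F.L : ℝ) * (2 * e + 2700 * (F.L : ℝ) * ε₀) := by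
  obtain ⟨hWF, hε, he6⟩ := windows_of_numerals F hε₀.le he hWe hWε
  have hd : (F.P K).d = 3 := T3Family.P_d F K
  have hLL : ((F.P K).L : ℝ) = F.L := rfl
  have hL3 : 3 ≤ F.L := by obtain ⟨a, ha⟩ := F.hL.1; have := F.hL.2; omega
  have hL0 : (0 : ℝ) < F.L := by exact_mod_cast (show 0 < F.L by omega)
  have hL1 : (1 : ℝ) ≤ ((F.P K).L : ℝ) := by rw [hLL]; exact_mod_cast (show 1 ≤ F.L by omega)
  have hk1 : j + 1 ≤ (F.P K).m + (F.P K).K := by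
    show j + 1 ≤ F.m + K; have := F.hm; omega
  have hℓ : ((((F.P K).d + 2) * (F.P K).L : ℕ) : ℝ) = 5 * (F.L : ℝ) := by
    rw [hd, ← hLL]; push_cast; ring
  obtain ⟨hsB0, hxX, hbud₀⟩ := budget_T3_frames F (n := n) (K := K) e hε₀ hε
  set η : ℝ := ((F.L : ℝ)⁻¹) ^ (K - n) with hη
  have hη0 : 0 < η := by positivity
  have hηne : η ≠ 0 := hη0.ne'
  have hηeta : eta F n K = η := rfl
  set a₀ : ℝ := regThreshold F n K ε₀ with ha₀
  have ha₀0 : 0 < a₀ := by rw [ha₀]; unfold regThreshold; positivity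
  have hXa : (F.L : ℝ) ^ (K - n) * ((F.L : ℝ) ^ (K - n) * a₀) = ε₀ := by
    have hX2 : (F.L : ℝ) ^ (K - n) * (F.L : ℝ) ^ (K - n) = (F.L : ℝ) ^ (2 * (K - n)) := by rw [← pow_add, two_mul]
    have ha : a₀ = ε₀ * ((F.L : ℝ) ^ (2 * (K - n)))⁻¹ := by rw [ha₀]; unfold regThreshold; rw [inv_pow]
    rw [← mul_assoc, hX2, ha, mul_comm ε₀, ← mul_assoc, mul_inv_cancel₀ (pow_ne_zero _ hL0.ne'), one_mul]
  have hU := hreg.1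
  obtain ⟨ht1, -, -, -⟩ := budget_T3 F (K - n) hε₀ hε he he6 ha₀0.le hXa
  -- the level-`j` budgets from the level-`(K − n)` ones (monotonicity in `j`)
  set ℓr : ℝ := ((((F.P K).d + 2) * (F.P K).L : ℕ) : ℝ) with hℓr
  have hℓ0 : 0 ≤ ℓr := Nat.cast_nonneg _
  have hpow : ((F.P K).L : ℝ) ^ j ≤ ((F.P K).L : ℝ) ^ (K - n) := pow_le_pow_right₀ hL1 hj
  have hpow0 : 0 ≤ ((F.P K).L : ℝ) ^ j := by positivity
  have hd0 : 0 ≤ ((F.P K).d : ℝ) := Nat.cast_nonneg _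
  set sBj : ℝ := 2 * (((F.P K).d : ℝ) * (3 * ((F.P K).L : ℝ) ^ j - 1)) * a₀ with hsBj
  set sBk : ℝ := 2 * (((F.P K).d : ℝ) * (3 * ((F.P K).L : ℝ) ^ (K - n) - 1)) * a₀ with hsBk
  have h3j : 0 ≤ 3 * ((F.P K).L : ℝ) ^ j - 1 := by linarith [one_le_pow₀ (n := j) hL1]
  have hsBj0 : 0 ≤ sBj := by rw [hsBj]; positivity
  have hsB : sBj ≤ sBk := by
    rw [hsBj, hsBk]
    have : ((F.P K).d : ℝ) * (3 * ((F.P K).L : ℝ) ^ j - 1) ≤ ((F.P K).d : ℝ) * (3 * ((F.P K).L : ℝ) ^ (K - n) - 1) :=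
      mul_le_mul_of_nonneg_left (by linarith) hd0
    nlinarith [ha₀0.le]
  have hte0 : 0 ≤ η * e := by positivity
  have hxj : ((F.P K).L : ℝ) ^ j * (2 * (η * e) + 30 * ℓr * sBj) ≤ ((F.P K).L : ℝ) ^ (K - n) * (2 * (η * e) + 30 * ℓr * sBk) := by
    apply mul_le_mul hpow _ (by positivity) (by positivity)
    nlinarith [mul_le_mul_of_nonneg_left hsB (by positivity : (0 : ℝ) ≤ 30 * ℓr)]
  have hbud₀j : 6400 * ℓr ^ 2 * ((F.P K).L : ℝ) ^ j * sBj ≤ 1 := by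
    refine le_trans ?_ hbud₀
    have h1 : 6400 * ℓr ^ 2 * ((F.P K).L : ℝ) ^ j * sBj ≤ 6400 * ℓr ^ 2 * ((F.P K).L : ℝ) ^ (K - n) * sBj :=
      mul_le_mul_of_nonneg_right (mul_le_mul_of_nonneg_left hpow (by positivity)) hsBj0
    have h2 : 6400 * ℓr ^ 2 * ((F.P K).L : ℝ) ^ (K - n) * sBj ≤ 6400 * ℓr ^ 2 * ((F.P K).L : ℝ) ^ (K - n) * sBk :=
      mul_le_mul_of_nonneg_left hsB (by positivity)
    exact h1.trans h2
  have hbudj : 8 * (16 * (22100 : ℝ) + 2) * ℓr ^ 2 * (((F.P K).L : ℝ) ^ j * (2 * (η * e) + 30 * ℓr * sBj)) ≤ 1 := by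
    have hC : 0 ≤ 8 * (16 * (22100 : ℝ) + 2) * ℓr ^ 2 := by positivity
    refine (mul_le_mul_of_nonneg_left (hxj.trans hxX) hC).trans ?_
    rw [hℓ]; exact hWF
  -- the reads of the rescaled exponent `A″ = (iη)⁻¹A`: `‖ηA″(b)‖ ≤ ηe`
  have hA' : ∀ b, ‖(η : ℂ) • ((fun b => (Complex.I * (η : ℂ))⁻¹ • A b) b)‖ ≤ η * e := fun b =>
    norm_smul_eta_inv_le F hηne A (fun b => by rw [← hηeta]; exact hA b) b
  -- every site is the source of a bond (`d = 3 ≥ 1`)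
  set e' : PBond (F.P K) j := ⟨x, ⟨0, (F.P K).hd⟩⟩ with he'
  obtain ⟨-, hsrc, -⟩ := norm_dbarCovIterU_rel_frameAccU_le_of_plaqSmall (P := F.P K) (by norm_num : (2 : ℝ) ≤ 22100) (hstep_T3 F) (hframe_T3 F) hk1 U₀ ha₀0 hU η
    (fun b => (Complex.I * (η : ℂ))⁻¹ • A b) ht1 hA' hbud₀j hbudj e'
  have hW : (fun b => expUnit (A b) * bgUnits F K U₀ b) = fun b => expCfg η (fun b => (Complex.I * (η : ℂ))⁻¹ • A b) b * unitsField (toUField U₀) b :=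
    perturbedField_eq F K hηne U₀ A
  rw [hW, bgUnits_eq]
  refine hsrc.trans ?_
  -- `6ℓ·x_j ≤ 6ℓ·(2e + 2700Lε₀) = 30L(2e + 2700Lε₀)`
  have h6 : 6 * ℓr * (((F.P K).L : ℝ) ^ j * (2 * (η * e) + 30 * ℓr * sBj)) ≤ 6 * ℓr * (2 * e + 2700 * (F.L : ℝ) * ε₀) :=
    mul_le_mul_of_nonneg_left (hxj.trans hxX) (by positivity)
  refine h6.trans (le_of_eq ?_)
  rw [hℓ]; ring

/-- the numeral: `30L(2e + 2700Lε₀) ≤ 10⁻⁷` under `10⁹L²e ≤ 1`, `10¹²L³ε₀ ≤ 1`, `L ≥ 3`. [folklore] -/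
theorem frameSup_numeral {ε₀ e : ℝ} (hε₀ : 0 ≤ ε₀) (he : 0 ≤ e) (hWe : 10 ^ 9 * (F.L : ℝ) ^ 2 * e ≤ 1) (hWε : 10 ^ 12 * (F.L : ℝ) ^ 3 * ε₀ ≤ 1) :
    30 * (F.L : ℝ) * (2 * e + 2700 * (F.L : ℝ) * ε₀) ≤ 1 / 10 ^ 7 := by
  have hL3 : 3 ≤ F.L := by obtain ⟨a, ha⟩ := F.hL.1; have := F.hL.2; omega
  have hL3r : (3 : ℝ) ≤ F.L := by exact_mod_cast hL3
  have hL0 : (0 : ℝ) < F.L := by linarith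
  -- `60·L·e ≤ 60∕(10⁹·L) ≤ 2·10⁻⁸` and `81000·L²·ε₀ ≤ 81000∕(10¹²·L) ≤ 2.7·10⁻⁸`
  have h1 : 3 * ((F.L : ℝ) * e) ≤ (F.L : ℝ) ^ 2 * e := by
    have := mul_le_mul_of_nonneg_right hL3r (mul_nonneg hL0.le he)
    nlinarith
  have h2 : 3 * ((F.L : ℝ) ^ 2 * ε₀) ≤ (F.L : ℝ) ^ 3 * ε₀ := by
    have := mul_le_mul_of_nonneg_right hL3r (mul_nonneg (sq_nonneg (F.L : ℝ)) hε₀)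
    nlinarith
  have e1 : 30 * (F.L : ℝ) * (2 * e + 2700 * (F.L : ℝ) * ε₀) = 60 * ((F.L : ℝ) * e) + 81000 * ((F.L : ℝ) ^ 2 * ε₀) := by ring
  rw [e1]
  nlinarith [mul_nonneg hL0.le he, mul_nonneg (sq_nonneg (F.L : ℝ)) hε₀]

/-- ★★ **THE FRAME SUP AT THE CHART POINT `U′ = e^{A₁}U₀`** (`‖A₁‖ < e·η`): `‖ν_j(x) − 1‖ ≤ 30L(2e + 2700Lε₀) ≤ 10⁻⁷` for `ν_j = frameAccU j U₀♭ U′♭`, every `j ≤ K − n`, every site.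
[cite: Balaban1985Averaging, (97) p.32, (161)-(163) p.42; Balaban1985Variational, (2) p.278, (44) p.285] -/
theorem norm_frameAccU_chart_sub_one_le_of_regPr {ε₀ e : ℝ} (hε₀ : 0 < ε₀) (he : 0 < e) (hWe : 10 ^ 9 * (F.L : ℝ) ^ 2 * e ≤ 1) (hWε : 10 ^ 12 * (F.L : ℝ) ^ 3 * ε₀ ≤ 1)
    (U₀ U' : GaugeField (F.P K) 0 (Matrix.specialUnitaryGroup (Fin 2) ℂ)) (hreg : RegPr F n K ε₀ U₀)
    (A₁ : PBond (F.P K) 0 → Matrix (Fin 2) (Fin 2) ℂ) (hA₁ : ‖A₁‖ < e * eta F n K)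
    (hU' : ∀ b, ((U' b : Matrix.specialUnitaryGroup (Fin 2) ℂ) : Matrix (Fin 2) (Fin 2) ℂ) = exp (A₁ b) * ((U₀ b : Matrix.specialUnitaryGroup (Fin 2) ℂ) : Matrix (Fin 2) (Fin 2) ℂ))
    {j : ℕ} (hj : j ≤ K - n) (x : Site (F.P K) j) :
    ‖((frameAccU j (bgUnits F K U₀) (bgUnits F K U') x : (Matrix (Fin 2) (Fin 2) ℂ)ˣ) : Matrix (Fin 2) (Fin 2) ℂ) - 1‖ ≤ 30 * (F.L : ℝ) * (2 * e + 2700 * (F.L : ℝ) * ε₀) ∧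
    ‖((frameAccU j (bgUnits F K U₀) (bgUnits F K U') x : (Matrix (Fin 2) (Fin 2) ℂ)ˣ) : Matrix (Fin 2) (Fin 2) ℂ) - 1‖ ≤ 1 / 10 ^ 7 := by
  have hA₁b : ∀ b, ‖A₁ b‖ ≤ e * eta F n K := fun b => (norm_le_pi_norm A₁ b).trans hA₁.le
  have h := norm_frameAccU_bgUnits_sub_one_le_of_regPr F hε₀ he.le hWe hWε U₀ hreg A₁ hA₁b hj x
  rw [← bgUnits_eq_expUnit_mul F U₀ U' A₁ hU'] at h
  exact ⟨h, h.trans (frameSup_numeral F hε₀.le he.le hWe hWε)⟩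

/-! ## §3 The single-bar ratio sups and (★) with `hv`∕`ha` discharged -/

/-- ★★ **THE SINGLE-BAR BOND RATIO OF THE TWO PLAIN TOWERS IS SMALL AT EVERY LEVEL `j ≤ K − n`**:
`‖Ū^{(j)}[U′♭](b)·Ū^{(j)}[U₀♭](b)⁻¹ − 1‖ ≤ 3(2e + 2700Lε₀) + 2·30L(2e + 2700Lε₀)` — by (97) `Ū′(b)Ū₀(b)⁻¹ = ν(b₋)·(V(b)Ū₀(b)⁻¹)·Ad_{Ū₀(b)}(ν(b₊)⁻¹)` with
`‖V(b)Ū₀(b)⁻¹ − 1‖ ≤ 3(2e + 2700Lε₀)` (✓`norm_dbarCovIterU_rel_sub_one_le_of_regPr`) and the two `SU(2)` frames within `30L(2e + 2700Lε₀)` of `1` (§3).  The sup letter of B2b's `δ`.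
[cite: Balaban1985Averaging, (97) p.32, (161)-(163) p.42; Balaban1985Variational, (2) p.278, (44) p.285] -/
theorem norm_emlIterU_chart_mul_inv_sub_one_le_of_regPr {ε₀ e : ℝ} (hε₀ : 0 < ε₀) (he : 0 < e) (hWe : 10 ^ 9 * (F.L : ℝ) ^ 2 * e ≤ 1)
    (hWε : 10 ^ 12 * (F.L : ℝ) ^ 3 * ε₀ ≤ 1)
    (U₀ U' : GaugeField (F.P K) 0 (Matrix.specialUnitaryGroup (Fin 2) ℂ)) (hreg : RegPr F n K ε₀ U₀)
    (A₁ : PBond (F.P K) 0 → Matrix (Fin 2) (Fin 2) ℂ) (hA₁ : ‖A₁‖ < e * eta F n K)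
    (hU' : ∀ b, ((U' b : Matrix.specialUnitaryGroup (Fin 2) ℂ) : Matrix (Fin 2) (Fin 2) ℂ) = exp (A₁ b) * ((U₀ b : Matrix.specialUnitaryGroup (Fin 2) ℂ) : Matrix (Fin 2) (Fin 2) ℂ))
    {j : ℕ} (hj : j ≤ K - n) (b : PBond (F.P K) j) :
    ‖((emlIterU j (bgUnits F K U') b : (Matrix (Fin 2) (Fin 2) ℂ)ˣ) : Matrix (Fin 2) (Fin 2) ℂ) *
          (((emlIterU j (bgUnits F K U₀) b)⁻¹ : (Matrix (Fin 2) (Fin 2) ℂ)ˣ) : Matrix (Fin 2) (Fin 2) ℂ) - 1‖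
      ≤ 3 * (2 * e + 2700 * (F.L : ℝ) * ε₀) + 2 * (30 * (F.L : ℝ) * (2 * e + 2700 * (F.L : ℝ) * ε₀)) := by
  have hε7 : 10 ^ 7 * (F.L : ℝ) ^ 3 * ε₀ ≤ 1 := window7_of_window12 F hε₀ hWε
  have hA₁b : ∀ b, ‖A₁ b‖ ≤ e * eta F n K := fun b => (norm_le_pi_norm A₁ b).trans hA₁.le
  have hcfg := bgUnits_eq_expUnit_mul F U₀ U' A₁ hU'
  set ν := frameAccU j (bgUnits F K U₀) (bgUnits F K U') with hνdef
  set V := dbarCovIterU j (bgUnits F K U₀) (bgUnits F K U') with hVdef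
  set Ub := emlIterU j (bgUnits F K U₀) b with hUb
  have hUb1 : Ub ∈ U1 (Matrix (Fin 2) (Fin 2) ℂ) := emlIterU_bgUnits_mem_U1_of_regPr F hε₀ hε7 hreg hj b
  have hν1 : ∀ x, ν x ∈ U1 (Matrix (Fin 2) (Fin 2) ℂ) := fun x =>
    specialUnitaryUnits_le_U1 (by rw [mem_specialUnitaryUnits]; exact frameAccU_bgUnits_mem_specialUnitaryGroup_of_regPr F hε₀ he hWe hWε U₀ U' hreg A₁ hA₁ hU' hj x)
  -- (97): `Ū′(b)Ū₀(b)⁻¹ = ν₋·(V Ū₀⁻¹)·(Ū₀ ν₊⁻¹ Ū₀⁻¹)`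
  have hVb : V b = (ν b.src)⁻¹ * emlIterU j (bgUnits F K U') b * ν b.tgt := by
    rw [hVdef, dbarCovIterU_eq_gaugeActT_frameAccU (bgUnits F K U₀) (bgUnits F K U') j, gaugeActT_apply, inv_inv]
  have e1 : emlIterU j (bgUnits F K U') b * Ub⁻¹ = ν b.src * (V b * Ub⁻¹) * (Ub * (ν b.tgt)⁻¹ * Ub⁻¹) := by
    rw [hVb]; group
  have hrel : ‖((V b : (Matrix (Fin 2) (Fin 2) ℂ)ˣ) : Matrix (Fin 2) (Fin 2) ℂ) * ((Ub⁻¹ : (Matrix (Fin 2) (Fin 2) ℂ)ˣ) : Matrix (Fin 2) (Fin 2) ℂ) - 1‖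
      ≤ 3 * (2 * e + 2700 * (F.L : ℝ) * ε₀) := by
    have h1 := norm_dbarCovIterU_rel_sub_one_le_of_regPr F hε₀ he.le hWe hWε U₀ hreg A₁ hA₁b hj b
    rw [← hcfg] at h1
    exact h1
  have hsrc := norm_frameAccU_bgUnits_sub_one_le_of_regPr F hε₀ he.le hWe hWε U₀ hreg A₁ hA₁b hj b.src
  have htgt := norm_frameAccU_bgUnits_sub_one_le_of_regPr F hε₀ he.le hWe hWε U₀ hreg A₁ hA₁b hj b.tgt
  rw [← hcfg] at hsrc htgt
  have hc : ‖((Ub * (ν b.tgt)⁻¹ * Ub⁻¹ : (Matrix (Fin 2) (Fin 2) ℂ)ˣ) : Matrix (Fin 2) (Fin 2) ℂ) - 1‖ ≤ 30 * (F.L : ℝ) * (2 * e + 2700 * (F.L : ℝ) * ε₀) := by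
    rw [Units.val_mul, Units.val_mul]
    exact (norm_units_conj_sub_one_le hUb1 _).trans ((norm_inv_sub_one_le (hν1 _)).trans htgt)
  rw [← Units.val_mul] at hrel
  rw [← Units.val_mul, e1, Units.val_mul, Units.val_mul]
  have h := norm_mul_mul_sub_one_le_of_U1 (hν1 b.src) ((U1 _).mul_mem ((U1 _).mul_mem hUb1 ((U1 _).inv_mem (hν1 b.tgt))) ((U1 _).inv_mem hUb1))
    ((V b * Ub⁻¹ : (Matrix (Fin 2) (Fin 2) ℂ)ˣ) : Matrix (Fin 2) (Fin 2) ℂ)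
  linarith [h, hrel, hsrc, hc]

/-- ★★★ **THE SINGLE-BAR STAIR RATIO `R_i(y)` IS SMALL AT EVERY LEVEL `j < K − n`** (B2c's `δ`): with `R_i(y) = Ū′^{(j)}(st_i)·Ū₀^{(j)}(st_i)⁻¹` the ratio transporter of the two PLAIN
towers along the centre stair `st_i` from `ŷ`, `‖R_i(y) − 1‖ ≤ 10⁻⁶ + 2·30L(2e + 2700Lε₀)` — B1's ✓`tstairU_eq_frame_inv_mul` read backwards, `R_i = ν(ŷ)·tstair_i·a_i⁻¹` with
`a_i = Ad_{Ū₀(st_i)}(ν(x_i))`, the twisted stair within `10⁻⁶` (✓`norm_tstairU_sub_one_le_of_regPr`) and the frames within `30L(2e + 2700Lε₀)` (§3), all letters `U1`.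
[cite: Balaban1985Averaging, (58) p.27, (97) p.32, (161)-(163) p.42; Balaban1985Variational, (2) p.278, (44) p.285] -/
theorem norm_stairRatio_sub_one_le_of_regPr {ε₀ e : ℝ} (hε₀ : 0 < ε₀) (he : 0 < e) (hWe : 10 ^ 9 * (F.L : ℝ) ^ 2 * e ≤ 1)
    (hWε : 10 ^ 12 * (F.L : ℝ) ^ 3 * ε₀ ≤ 1)
    (U₀ U' : GaugeField (F.P K) 0 (Matrix.specialUnitaryGroup (Fin 2) ℂ)) (hreg : RegPr F n K ε₀ U₀)
    (A₁ : PBond (F.P K) 0 → Matrix (Fin 2) (Fin 2) ℂ) (hA₁ : ‖A₁‖ < e * eta F n K)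
    (hU' : ∀ b, ((U' b : Matrix.specialUnitaryGroup (Fin 2) ℂ) : Matrix (Fin 2) (Fin 2) ℂ) = exp (A₁ b) * ((U₀ b : Matrix.specialUnitaryGroup (Fin 2) ℂ) : Matrix (Fin 2) (Fin 2) ℂ))
    {j : ℕ} (hj : j < K - n) (y : Site (F.P K) (j + 1)) (i : Idx (F.P K)) :
    ‖((holT (emlIterU j (bgUnits F K U')) (emb y) (stairWord i.2.1 (off i.1)) * (holT (emlIterU j (bgUnits F K U₀)) (emb y) (stairWord i.2.1 (off i.1)))⁻¹ :
          (Matrix (Fin 2) (Fin 2) ℂ)ˣ) : Matrix (Fin 2) (Fin 2) ℂ) - 1‖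
      ≤ 1 / 10 ^ 6 + 2 * (30 * (F.L : ℝ) * (2 * e + 2700 * (F.L : ℝ) * ε₀)) := by
  have hε7 : 10 ^ 7 * (F.L : ℝ) ^ 3 * ε₀ ≤ 1 := window7_of_window12 F hε₀ hWε
  have hA₁b : ∀ b, ‖A₁ b‖ ≤ e * eta F n K := fun b => (norm_le_pi_norm A₁ b).trans hA₁.le
  have hcfg := bgUnits_eq_expUnit_mul F U₀ U' A₁ hU'
  set ν := frameAccU j (bgUnits F K U₀) (bgUnits F K U') with hνdef
  set νst := holT (emlIterU j (bgUnits F K U₀)) (emb y) (stairWord i.2.1 (off i.1)) with hνst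
  set R := holT (emlIterU j (bgUnits F K U')) (emb y) (stairWord i.2.1 (off i.1)) * νst⁻¹ with hR
  set a := νst * ν (transl (emb y) (disp (stairWord i.2.1 (off i.1)))) * νst⁻¹ with ha
  have hνst1 : νst ∈ U1 (Matrix (Fin 2) (Fin 2) ℂ) := holT_mem_U1 (fun b => emlIterU_bgUnits_mem_U1_of_regPr F hε₀ hε7 hreg hj.le b) _ _
  have hν1 : ∀ x, ν x ∈ U1 (Matrix (Fin 2) (Fin 2) ℂ) := fun x =>
    specialUnitaryUnits_le_U1 (by rw [mem_specialUnitaryUnits]; exact frameAccU_bgUnits_mem_specialUnitaryGroup_of_regPr F hε₀ he hWe hWε U₀ U' hreg A₁ hA₁ hU' hj.le x)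
  have ha1 : a ∈ U1 (Matrix (Fin 2) (Fin 2) ℂ) := (U1 _).mul_mem ((U1 _).mul_mem hνst1 (hν1 _)) ((U1 _).inv_mem hνst1)
  -- B1's identity read backwards: `R = ν(ŷ)·tstair·a⁻¹`
  have e1 : R = ν (emb y) * tstairU (emlIterU j (bgUnits F K U₀)) (dbarCovIterU j (bgUnits F K U₀) (bgUnits F K U')) y i * a⁻¹ := by
    rw [tstairU_eq_frame_inv_mul j (bgUnits F K U₀) (bgUnits F K U') y i, hR, ha]
    simp only [← hνdef, ← hνst]
    group
  have ht := norm_tstairU_sub_one_le_of_regPr F hε₀ he hWe hWε U₀ U' hreg A₁ hA₁ hU' hj y i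
  have hy := norm_frameAccU_bgUnits_sub_one_le_of_regPr F hε₀ he.le hWe hWε U₀ hreg A₁ hA₁b hj.le (emb y)
  have hx := norm_frameAccU_bgUnits_sub_one_le_of_regPr F hε₀ he.le hWe hWε U₀ hreg A₁ hA₁b hj.le (transl (emb y) (disp (stairWord i.2.1 (off i.1))))
  rw [← hcfg] at hy hx
  have hainv : ‖((a⁻¹ : (Matrix (Fin 2) (Fin 2) ℂ)ˣ) : Matrix (Fin 2) (Fin 2) ℂ) - 1‖ ≤ 30 * (F.L : ℝ) * (2 * e + 2700 * (F.L : ℝ) * ε₀) := by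
    refine (norm_inv_sub_one_le ha1).trans ?_
    rw [ha, Units.val_mul, Units.val_mul]
    exact (norm_units_conj_sub_one_le hνst1 _).trans hx
  rw [e1, Units.val_mul, Units.val_mul]
  have h := norm_mul_mul_sub_one_le_of_U1 (hν1 (emb y)) ((U1 _).inv_mem ha1)
    ((tstairU (emlIterU j (bgUnits F K U₀)) (dbarCovIterU j (bgUnits F K U₀) (bgUnits F K U')) y i : (Matrix (Fin 2) (Fin 2) ℂ)ˣ) : Matrix (Fin 2) (Fin 2) ℂ)
  linarith [h, ht, hy, hx, hainv]

/-- ★★★ **(★) AT THE T³ MEMBER WITH `hv`∕`ha` DISCHARGED** — ✓`Prop7AccumulatedFrameStep.norm_frameAccU_succ_sub_one_le` at the pair `(U₀♭, U′♭)`, `k < K − n`: the centre frame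
`ν_k(ŷ)` and the conjugated end frames `Ad_{Ū₀(st_i)}(ν_k(x_i))` have norm `≤ 1` (special unitary ∕ `U1`, ✓`frameAccU_bgUnits_mem_specialUnitaryGroup_of_regPr`, ✓`holT_mem_U1`),
so only the site-wise stair letter `t` (`‖tstair_i(y) − 1‖ ≤ t ≤ ¼`, inhabitable by `10⁻⁶` ✓`norm_tstairU_sub_one_le_of_regPr`) remains displayed, as B2c wants it:
`‖ν_{k+1}(y) − 1‖ ≤ |Idx|⁻¹·Σ_i (‖R_i(y) − 1‖ + ‖a_i(y) − 1‖) + 6t²`. [cite: Balaban1985Averaging, (82) p.30, (97) p.32, (26)-(27) p.22; Balaban1985Variational, (44) p.285] -/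
theorem norm_frameAccU_succ_sub_one_le_of_regPr {ε₀ e : ℝ} (hε₀ : 0 < ε₀) (he : 0 < e) (hWe : 10 ^ 9 * (F.L : ℝ) ^ 2 * e ≤ 1)
    (hWε : 10 ^ 12 * (F.L : ℝ) ^ 3 * ε₀ ≤ 1)
    (U₀ U' : GaugeField (F.P K) 0 (Matrix.specialUnitaryGroup (Fin 2) ℂ)) (hreg : RegPr F n K ε₀ U₀)
    (A₁ : PBond (F.P K) 0 → Matrix (Fin 2) (Fin 2) ℂ) (hA₁ : ‖A₁‖ < e * eta F n K)
    (hU' : ∀ b, ((U' b : Matrix.specialUnitaryGroup (Fin 2) ℂ) : Matrix (Fin 2) (Fin 2) ℂ) = exp (A₁ b) * ((U₀ b : Matrix.specialUnitaryGroup (Fin 2) ℂ) : Matrix (Fin 2) (Fin 2) ℂ))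
    {k : ℕ} (hk : k < K - n) (y : Site (F.P K) (k + 1)) {t : ℝ}
    (ht : ∀ i : Idx (F.P K), ‖((tstairU (emlIterU k (bgUnits F K U₀)) (dbarCovIterU k (bgUnits F K U₀) (bgUnits F K U')) y i : (Matrix (Fin 2) (Fin 2) ℂ)ˣ) :
      Matrix (Fin 2) (Fin 2) ℂ) - 1‖ ≤ t) (ht4 : t ≤ 1 / 4) :
    ‖((frameAccU (k + 1) (bgUnits F K U₀) (bgUnits F K U') y : (Matrix (Fin 2) (Fin 2) ℂ)ˣ) : Matrix (Fin 2) (Fin 2) ℂ) - 1‖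
      ≤ (Fintype.card (Idx (F.P K)) : ℝ)⁻¹ * ∑ i : Idx (F.P K),
          (‖((holT (emlIterU k (bgUnits F K U')) (emb y) (stairWord i.2.1 (off i.1)) * (holT (emlIterU k (bgUnits F K U₀)) (emb y) (stairWord i.2.1 (off i.1)))⁻¹ :
                (Matrix (Fin 2) (Fin 2) ℂ)ˣ) : Matrix (Fin 2) (Fin 2) ℂ) - 1‖
            + ‖((holT (emlIterU k (bgUnits F K U₀)) (emb y) (stairWord i.2.1 (off i.1)) * frameAccU k (bgUnits F K U₀) (bgUnits F K U') (transl (emb y) (disp (stairWord i.2.1 (off i.1))))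
                * (holT (emlIterU k (bgUnits F K U₀)) (emb y) (stairWord i.2.1 (off i.1)))⁻¹ : (Matrix (Fin 2) (Fin 2) ℂ)ˣ) : Matrix (Fin 2) (Fin 2) ℂ) - 1‖)
        + 6 * t ^ 2 := by
  have hε7 : 10 ^ 7 * (F.L : ℝ) ^ 3 * ε₀ ≤ 1 := window7_of_window12 F hε₀ hWε
  have hν1 : ∀ x, frameAccU k (bgUnits F K U₀) (bgUnits F K U') x ∈ U1 (Matrix (Fin 2) (Fin 2) ℂ) := fun x =>
    specialUnitaryUnits_le_U1 (by rw [mem_specialUnitaryUnits]; exact frameAccU_bgUnits_mem_specialUnitaryGroup_of_regPr F hε₀ he hWe hWε U₀ U' hreg A₁ hA₁ hU' hk.le x)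
  have hνst1 : ∀ i : Idx (F.P K), holT (emlIterU k (bgUnits F K U₀)) (emb y) (stairWord i.2.1 (off i.1)) ∈ U1 (Matrix (Fin 2) (Fin 2) ℂ) := fun i =>
    holT_mem_U1 (fun b => emlIterU_bgUnits_mem_U1_of_regPr F hε₀ hε7 hreg hk.le b) _ _
  refine norm_frameAccU_succ_sub_one_le k (bgUnits F K U₀) (bgUnits F K U') y (mem_U1.1 (hν1 (emb y))).1 (fun i => ?_) ht ht4
  exact (mem_U1.1 ((U1 _).mul_mem ((U1 _).mul_mem (hνst1 i) (hν1 _)) ((U1 _).inv_mem (hνst1 i)))).1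

end T3

end Summit.QuantumFields.YangMills.Theorems.Prop7AccumulatedFrameSupT3

end
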